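import Mathlib
import Literature.MathematicalPhysics.QuantumFieldTheory.Balaban1983to89.B16SupCountCeiling

/-!
# `Balaban1983to89.B16.SupCountBranching` — branch points raise the cube count in the cell's typed (SUP-metric)
tree-length model: CENTRE STARS refute the conjectured sharp slope 2^d − 1 for trees (every d ≥ 3) and put the
optimal tree slope at d = 4 in [35/2, 30]

CITATION HEADER (lean-in-tree rule 2026-08-18).  Sources: T. Bałaban, *Large field renormalization. II. Localization,
exponentiation, and bounds for the 𝐑 operation*, Commun. Math. Phys. **122**, 355–392 (1989) [Balaban1989LargeFieldII]
(cell paper B16; held `paper:balaban1989-cmp122-large-field-ii`, journal page = PDF page + 354): p. 385 [PDF 31] prints the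
count of M-cubes met by a tree graph as «7^d(3·2^{d−1}d′₁(Z₁^{(i)}) + 2^d)» (slope 3·2^{d−1} = 24 at d = 4, additive 2^d),
and (1.93) p. 388 [PDF 34] uses the reciprocal constant (3·2^d)^{−1}; T. Bałaban, *Renormalization group approach to
lattice gauge field theories. I*, Commun. Math. Phys. **109**, 249–301 (1987) [Balaban1987RG1] p. 257 (linear size d_j of
a localization domain through tree graphs; no metric named — cell DIVERGENCE.md D-T2); J. Dimock, *The renormalization
group according to Bałaban II. Large fields*, J. Math. Phys. **54**, 092301 (2013), arXiv:1212.5562v2 [Dimock2013BalabanII]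
App. E (sup-metric convention of the typed model).  The Bałaban papers are manuscripts UNDER ADJUDICATION by the audit
cell `pub-balaban`: nothing printed in them is asserted here; every `theorem` below is an elementary statement of the
typed model about explicit star graphs and explicit finite families of unit cubes, proved without `sorry` and without
new axioms (two cardinalities of explicit finite sets, 23 and 51, are evaluated by the kernel, `decide +kernel`).  NEW
leaf module of unit `b2b-balaban-b01` (gen 23; cell records GAPS.md C-b01g23-1, DIVERGENCE.md D-b01g15.1 UPDATE-3); it
imports `…B16.SupCountCeiling` (unit b01, gen 22; through it `…B16.SupCountFloor`, gen 15, and `…TreeLength`, unit pv22)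
and modifies nothing.  No statement in print is known to the cell for the question decided here (presearch of gens 15/22:
nearest is the d = 2 EUCLIDEAN pixel count of Gerard–Vacavant–Favreau, Theoret. Comput. Sci. **624** (2016) 41–55, other
metric); the statements below are tagged [folklore].

THE TYPED MODEL (`…TreeLength`): closed unit cubes `cube y = [y, y + 1]^d`, y ∈ ℤ^d, of ℝ^d with Mathlib's SUP metric; a
polygonal graph is a list T of segments, `len T` the sum of their sup-lengths, `carrier T` their union; `SAdmissible Y T` =
the carrier is connected and meets every cube of Y.  STATE BEFORE THIS MODULE (`…B16.SupCountFloor`, `…B16.SupCountCeiling`):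
for a count `SAdmissible Y T → #Y ≤ c·len T + 2^d` valid for ALL connected graphs the optimal slope c_d satisfies
2^d − 1 ≤ c_d ≤ 2(2^d − 1) (`slope_bracket`; [15, 30] at d = 4), and for polygonal PATHS the optimal slope is exactly
2^d − 1 (`card_le_of_isPath_sAdmissible`, `path_slope_sharp`); both module headers record the cell's conjecture (D-b01g15.1)
that the sharp slope for trees with branch points is also 2^d − 1.  THIS MODULE REFUTES THAT CONJECTURE for every d ≥ 3.

THE OBJECT.  For a lattice point s ∈ ℤ^d, `touch s` is the set of the 2^d unit cubes having s as a vertex (indices y with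
y_μ ∈ {s_μ − 1, s_μ}).  For a list S of lattice points, the CENTRE STAR `ctrStar S` is the graph of the segments from the
centre (½,…,½) of the cube of index 0 to the points of S, and `starCubes S = ⋃_{s ∈ S} touch s`.  If S ⊆ {0,1}^d (the
vertices of the cube of index 0) every segment has sup-length exactly ½ (`len_ctrStar`: len = #S/2, d ≥ 1), and the star is
Steiner-admissible for `starCubes S` (`sAdmissible_ctrStar`: connected through the hub, meeting each cube of `touch s` at
its vertex s).  Heuristic: a branch of sup-length ½ from the centre to a vertex s collects the 2^d cubes at s minus the
overlaps with the other branches, whereas by (P) a PATH gains at most (2^d − 1)·½ cubes per length ½; for a code S of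
large pairwise Hamming distance the overlaps (2^{d − dist} per pair) are small enough to beat the slope 2^d − 1 once d ≥ 3.

WHAT IS PROVED.
(4) d = 4, the dimension of [Balaban1989LargeFieldII] (1.93): the centre star `S4` to the four vertices 0100, 0111, 1001,
  1010 (a binary code of pairwise Hamming distance ≥ 2) has length 2 and meets exactly 51 cubes (`card_starCubes_S4`,
  kernel evaluation; by inclusion–exclusion 4·16 − (4+2+2+2+2+4) + 4 − 1), whereas (2^4 − 1)·2 + 2^4 = 46: so
  `conj_slope_fails_four` — the count `#Y ≤ 15·len T + 16`, valid for paths (`SupCountCeiling.card_le_of_isPath_four`),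
  FAILS for trees — and `tree_count_floor_four`: every slope c valid for all connected graphs at d = 4 satisfies
  c ≥ 35/2; `tree_slope_bracket_four`: 35/2 ≤ c_4 ≤ 30; `path_tree_gap_four`: paths and trees have different optimal
  slopes at d = 4 (15 versus ≥ 35/2).  `printed_vs_star_four` (numerics): the printed slope 3·2^{d−1} = 24 is NOT refuted
  by this star (24·2 + 16 = 64 ≥ 51) and lies inside the new bracket [35/2, 30].
(3) d = 3: the centre star `S3` to 000, 011, 101, 110 (the even-weight code) has length 2 and meets exactly 23 cubes
  (`card_starCubes_S3`), one more than (2^3 − 1)·2 + 2^3 = 22: `conj_slope_fails_three`, `tree_count_floor_three` (c ≥ 15/2).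
(d) every d ≥ 2: the three-branch star `threeStar` to 0, (1,…,1) and (1,1,0,…,0) has length 3/2 and meets exactly
  11·2^{d−2} − 4 cubes (`card_starCubes_threeStar`, by inclusion–exclusion over the product structure of `touch`:
  `card_touch`, `touch_inter`, `card_touch_inter`), whence `count_floor_threeStar`: c_d ≥ (7·2^{d−1} − 8)/3, which exceeds
  2^d − 1 as soon as d ≥ 4; with (3): `conj_slope_fails` — for EVERY d ≥ 3 the slope 2^d − 1 is not valid for trees, i.e.
  the optimal tree slope is strictly larger than the optimal path slope.
WHAT IS *NOT* PROVED: the exact optimal tree slope c_d for any d ≥ 2 (d = 4: 35/2 ≤ c_4 ≤ 30 is all that is kernel-checked;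
outside Lean, the cell records `pub-balaban/b2b-balaban-b01-g23/slope/` show by a rooted-tree subadditivity bound and a
two-engine table of maximal vertex-star unions that 35/2 is the EXACT optimum of (#Y − 16)/len over the sub-family of trees
whose vertices are cube centres and cube vertices joined by sup-length-½ edges; trees outside that family were not
searched — so whether the PRINTED slope 24 holds verbatim for trees in the sup typing remains OPEN, and by GAPS C-b01g15-3 A1
it is not load-bearing for (1.93)/(1.97): any linear count with additive 2^d suffices after constant chasing); d = 2
(centre stars give nothing beyond the floor 3; bracket [3, 6]); anything about the Euclidean or ℓ¹ lengths (not typed).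
As d → ∞, k-branch centre stars on binary codes with k → ∞ and k·2^{−(min. distance)} → 0 have slopes approaching the
ceiling 2(2^d − 1) of `SupCountCeiling.card_le_two_mul_sub` in ratio (record-only remark, not typed).  Value: kernel-checked
bookkeeping — a recorded conjecture of the cell about its own typed model settled in the negative, with explicit
constants — NOT summit progress, NOT a claim about the manuscripts.
-/

namespace Literature.MathematicalPhysics.QuantumFieldTheory.Balaban1983to89.B16.SupCountBranching

noncomputable section

open Literature.MathematicalPhysics.QuantumFieldTheory.Balaban1983to89.B13ScaleTransfer (Pt)
open Literature.MathematicalPhysics.QuantumFieldTheory.Balaban1983to89.TreeLength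
open Literature.MathematicalPhysics.QuantumFieldTheory.Balaban1983to89.B16.SupCountCeiling (ctr)

variable {d : ℕ}

/-! ## Part 1. The 2^d cubes at a lattice vertex and their product structure -/

/-- The unit cubes having the lattice point s ∈ ℤ^d as a vertex: the indices y with y_μ ∈ {s_μ − 1, s_μ}. [folklore] -/
def touch (s : Pt d) : Finset (Pt d) := Fintype.piFinset fun i => ({s i - 1, s i} : Finset ℤ)

/-- Membership in `touch s`, coordinatewise. [folklore] -/
theorem mem_touch {s y : Pt d} : y ∈ touch s ↔ ∀ i, y i = s i - 1 ∨ y i = s i := by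
  simp [touch, Fintype.mem_piFinset]

/-- The lattice point s lies in (is a vertex of) every cube of `touch s`. [folklore] -/
theorem corner_mem_cube_of_mem_touch {s y : Pt d} (h : y ∈ touch s) : corner s ∈ cube y := by
  refine mem_cube.2 fun i => ?_
  simp only [corner]
  rcases mem_touch.1 h i with h' | h' <;> rw [h'] <;> push_cast <;> constructor <;> linarith

/-- The cube of index 0 has every point of {0,1}^d as a vertex: 0 ∈ `touch s` for s ∈ {0,1}^d. [folklore] -/
theorem zero_mem_touch {s : Pt d} (hs : ∀ i, s i = 0 ∨ s i = 1) : (0 : Pt d) ∈ touch s :=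
  mem_touch.2 fun i => by rcases hs i with h | h <;> simp [h]

/-- `touch s` has exactly 2^d elements. [folklore] -/
theorem card_touch (s : Pt d) : (touch s).card = 2 ^ d := by
  rw [touch, Fintype.card_piFinset, Finset.prod_congr rfl fun i _ => Finset.card_pair (show s i - 1 ≠ s i by omega)]
  simp

/-- PRODUCT STRUCTURE: the cubes at two vertices s, t are the product of the coordinate intersections. [folklore] -/
theorem touch_inter (s t : Pt d) :
    touch s ∩ touch t = Fintype.piFinset fun i => ({s i - 1, s i} ∩ {t i - 1, t i} : Finset ℤ) := by
  ext y
  simp only [touch, Finset.mem_inter, Fintype.mem_piFinset, forall_and]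

/-- Hence the number of cubes at both s and t is the product of the coordinate counts (2 where s_μ = t_μ, 1 where
|s_μ − t_μ| = 1, 0 otherwise). [folklore] -/
theorem card_touch_inter (s t : Pt d) :
    (touch s ∩ touch t).card = ∏ i, (({s i - 1, s i} ∩ {t i - 1, t i} : Finset ℤ)).card := by
  rw [touch_inter, Fintype.card_piFinset]

/-! ## Part 2. Centre stars -/

/-- The CENTRE STAR of a list S of lattice points: the segments from the centre (½,…,½) of the cube of index 0 to the
points of S. [folklore] -/
def ctrStar (S : List (Pt d)) : List (Seg d) := S.map fun s => (ctr (0 : Pt d), corner s)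

/-- The cubes having a vertex in the list S. [folklore] -/
def starCubes (S : List (Pt d)) : Finset (Pt d) := (S.map touch).foldr (· ∪ ·) ∅

/-- `starCubes` of the empty list. [folklore] -/
@[simp] theorem starCubes_nil : starCubes ([] : List (Pt d)) = ∅ := rfl

/-- `starCubes` of a list with one more point. [folklore] -/
@[simp] theorem starCubes_cons (s : Pt d) (S : List (Pt d)) : starCubes (s :: S) = touch s ∪ starCubes S := rfl

/-- Membership in `starCubes S`. [folklore] -/
theorem mem_starCubes {S : List (Pt d)} {y : Pt d} : y ∈ starCubes S ↔ ∃ s ∈ S, y ∈ touch s := by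
  induction S with
  | nil => simp
  | cons s S ih => simp [ih]

/-- Length of a centre star with one more branch. [folklore] -/
@[simp] theorem len_ctrStar_cons (s : Pt d) (S : List (Pt d)) :
    len (ctrStar (s :: S)) = dist (ctr (0 : Pt d)) (corner s) + len (ctrStar S) := rfl

/-- Length of the empty centre star. [folklore] -/
@[simp] theorem len_ctrStar_nil : len (ctrStar ([] : List (Pt d))) = 0 := rfl

/-- A vertex of the cube of index 0 is at sup-distance exactly ½ from its centre (d ≥ 1). [folklore] -/
theorem dist_ctr_corner (hd : 0 < d) {s : Pt d} (hs : ∀ i, s i = 0 ∨ s i = 1) :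
    dist (ctr (0 : Pt d)) (corner s) = 1 / 2 := by
  have hi : ∀ i, dist (ctr (0 : Pt d) i) (corner s i) = 1 / 2 := by
    intro i
    rw [Real.dist_eq, SupCountCeiling.ctr, corner]
    rcases hs i with h | h <;> norm_num [h]
  refine le_antisymm ((dist_pi_le_iff (by norm_num)).2 fun i => (hi i).le) ?_
  have h := dist_le_pi_dist (ctr (0 : Pt d)) (corner s) ⟨0, hd⟩
  rwa [hi] at h

/-- A centre star to k vertices of the cube of index 0 has sup-length k/2 (d ≥ 1). [folklore] -/
theorem len_ctrStar (hd : 0 < d) {S : List (Pt d)} (hS : ∀ s ∈ S, ∀ i, s i = 0 ∨ s i = 1) :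
    len (ctrStar S) = S.length / 2 := by
  induction S with
  | nil => simp
  | cons s S ih =>
    rw [len_ctrStar_cons, dist_ctr_corner hd (hS s (by simp)), ih fun t ht => hS t (by simp [ht]),
      List.length_cons]
    push_cast
    ring

/-- The centre star together with its hub is preconnected. [folklore] -/
theorem isPreconnected_insert_carrier_ctrStar (S : List (Pt d)) :
    IsPreconnected (insert (ctr (0 : Pt d)) (carrier (ctrStar S))) := by
  induction S with
  | nil => simpa [ctrStar] using isPreconnected_singleton
  | cons s S ih =>
    have heq : insert (ctr (0 : Pt d)) (carrier (ctrStar (s :: S)))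
        = segment ℝ (ctr (0 : Pt d)) (corner s) ∪ insert (ctr (0 : Pt d)) (carrier (ctrStar S)) := by
      simp only [ctrStar, List.map_cons, carrier_cons, Set.union_insert]
    rw [heq]
    exact IsPreconnected.union (ctr 0) (left_mem_segment ℝ _ _) (Set.mem_insert _ _)
      (convex_segment _ _).isPreconnected ih

/-- Every point of S lies on the centre star of S (as the far endpoint of its branch). [folklore] -/
theorem corner_mem_carrier_ctrStar {S : List (Pt d)} {s : Pt d} (hs : s ∈ S) :
    corner s ∈ carrier (ctrStar S) :=
  segment_subset_carrier (T := ctrStar S) (s := (ctr 0, corner s)) (List.mem_map.2 ⟨s, hs, rfl⟩)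
    (right_mem_segment ℝ _ _)

/-- The hub lies on a centre star with at least one branch. [folklore] -/
theorem ctr_mem_carrier_ctrStar {S : List (Pt d)} (hS : S ≠ []) : ctr (0 : Pt d) ∈ carrier (ctrStar S) := by
  obtain ⟨s, hs⟩ := List.exists_mem_of_ne_nil S hS
  exact segment_subset_carrier (T := ctrStar S) (s := (ctr 0, corner s)) (List.mem_map.2 ⟨s, hs, rfl⟩)
    (left_mem_segment ℝ _ _)

/-- A centre star with at least one branch is Steiner-admissible for the cubes having a vertex in S: it is connected
(through the hub) and meets each such cube (at that vertex). [folklore] -/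
theorem sAdmissible_ctrStar {S : List (Pt d)} (hS : S ≠ []) : SAdmissible (starCubes S) (ctrStar S) := by
  refine ⟨⟨⟨_, ctr_mem_carrier_ctrStar hS⟩, ?_⟩, fun y hy => ?_⟩
  · have h := isPreconnected_insert_carrier_ctrStar S
    rwa [Set.insert_eq_of_mem (ctr_mem_carrier_ctrStar hS)] at h
  · obtain ⟨s, hs, hys⟩ := mem_starCubes.1 hy
    exact ⟨corner s, corner_mem_carrier_ctrStar hs, corner_mem_cube_of_mem_touch hys⟩

/-- THE STAR INEQUALITY: a count `#Y ≤ c·len T + 2^d` valid for all connected graphs, applied to the centre star of a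
non-empty list S ⊆ {0,1}^d, gives #(starCubes S) ≤ c·#S/2 + 2^d (d ≥ 1). [folklore] -/
theorem card_starCubes_le (hd : 0 < d) {S : List (Pt d)} (hS : S ≠ []) (h01 : ∀ s ∈ S, ∀ i, s i = 0 ∨ s i = 1)
    {c : ℝ} (h : ∀ (Y : Finset (Pt d)) (T : List (Seg d)), SAdmissible Y T → (Y.card : ℝ) ≤ c * len T + 2 ^ d) :
    ((starCubes S).card : ℝ) ≤ c * (S.length / 2) + 2 ^ d := by
  have h1 := h _ _ (sAdmissible_ctrStar hS)
  rwa [len_ctrStar hd h01] at h1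

/-! ## Part 3. d = 4: the star to the code {0100, 0111, 1001, 1010} — 51 cubes, length 2 -/

/-- The four branch ends at d = 4: vertices 0100, 0111, 1001, 1010 of the cube of index 0 (pairwise Hamming distance
2, 3, 3, 3, 3, 2). [folklore] -/
def S4 : List (Pt 4) := [![0, 1, 0, 0], ![0, 1, 1, 1], ![1, 0, 0, 1], ![1, 0, 1, 0]]

/-- The branch ends of `S4` are vertices of the cube of index 0. [folklore] -/
theorem S4_01 : ∀ s ∈ S4, ∀ i, s i = 0 ∨ s i = 1 := by decide

/-- The centre star `S4` meets exactly 51 cubes (kernel evaluation of an explicit finite set; inclusion–exclusion: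
64 − 16 + 4 − 1). [folklore] -/
theorem card_starCubes_S4 : (starCubes S4).card = 51 := by decide +kernel

/-- The centre star `S4` has sup-length 2. [folklore] -/
theorem len_ctrStar_S4 : len (ctrStar S4) = 2 := by
  rw [len_ctrStar (by norm_num) S4_01]
  norm_num [S4]

/-- The centre star `S4` is Steiner-admissible for its 51 cubes. [folklore] -/
theorem sAdmissible_S4 : SAdmissible (starCubes S4) (ctrStar S4) := sAdmissible_ctrStar (by simp [S4])

/-- TREE FLOOR AT d = 4: every slope c with `SAdmissible Y T → #Y ≤ c·len T + 2^4` for all Y, T satisfies c ≥ 35/2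
(51 ≤ 2c + 16). [folklore] -/
theorem tree_count_floor_four {c : ℝ}
    (h : ∀ (Y : Finset (Pt 4)) (T : List (Seg 4)), SAdmissible Y T → (Y.card : ℝ) ≤ c * len T + 2 ^ 4) :
    (35 : ℝ) / 2 ≤ c := by
  have h1 := card_starCubes_le (by norm_num) (by simp [S4]) S4_01 h
  rw [card_starCubes_S4] at h1
  norm_num [S4] at h1
  linarith

/-- THE CONJECTURED TREE SLOPE 2^d − 1 FAILS AT d = 4: `#Y ≤ 15·len T + 16` — valid for polygonal paths
(`SupCountCeiling.card_le_of_isPath_four`) — is violated by the centre star `S4` (51 > 46). [folklore] -/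
theorem conj_slope_fails_four :
    ¬ ∀ (Y : Finset (Pt 4)) (T : List (Seg 4)), SAdmissible Y T → (Y.card : ℝ) ≤ (2 ^ 4 - 1) * len T + 2 ^ 4 := by
  intro h
  have := tree_count_floor_four h
  norm_num at this

/-- THE TREE BRACKET AT d = 4: the optimal slope c_4 of a count `#Y ≤ c·len T + 16` valid for all connected polygonal
graphs satisfies 35/2 ≤ c_4 ≤ 30 (floor: this module; ceiling: `SupCountCeiling.card_le_four`). [folklore] -/
theorem tree_slope_bracket_four :
    (∀ c : ℝ, (∀ (Y : Finset (Pt 4)) (T : List (Seg 4)), SAdmissible Y T → (Y.card : ℝ) ≤ c * len T + 2 ^ 4) →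
        (35 : ℝ) / 2 ≤ c) ∧
      (∀ (Y : Finset (Pt 4)) (T : List (Seg 4)), SAdmissible Y T → (Y.card : ℝ) ≤ 30 * len T + 2 ^ 4) := by
  refine ⟨fun _ hc => tree_count_floor_four hc, fun Y T hT => ?_⟩
  have := SupCountCeiling.card_le_four hT
  norm_num
  linarith

/-- PATHS AND TREES DIFFER AT d = 4: slope 15 is valid for every polygonal path but not for every connected polygonal
graph. [folklore] -/
theorem path_tree_gap_four :
    (∀ (Y : Finset (Pt 4)) (T : List (Seg 4)), SupCountCeiling.IsPath T → SAdmissible Y T →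
        (Y.card : ℝ) ≤ 15 * len T + 2 ^ 4) ∧
      ¬ ∀ (Y : Finset (Pt 4)) (T : List (Seg 4)), SAdmissible Y T → (Y.card : ℝ) ≤ 15 * len T + 2 ^ 4 := by
  refine ⟨fun Y T hP hT => ?_, fun h => ?_⟩
  · have := SupCountCeiling.card_le_of_isPath_four hP hT
    norm_num
    linarith
  · have := tree_count_floor_four h
    norm_num at this

/-- NUMERICS AT d = 4: the printed slope 3·2^{d−1} = 24 is consistent with the star `S4` (24·2 + 16 = 64 ≥ 51) and lies
inside the kernel-checked tree bracket: 15 < 35/2 < 24 < 30. [folklore] -/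
theorem printed_vs_star_four :
    (3 : ℝ) * 2 ^ (4 - 1) = 24 ∧ (51 : ℝ) ≤ 24 * 2 + 2 ^ 4 ∧
      (2 : ℝ) ^ 4 - 1 < 35 / 2 ∧ (35 : ℝ) / 2 < 3 * 2 ^ (4 - 1) ∧ (3 : ℝ) * 2 ^ (4 - 1) < 2 * (2 ^ 4 - 1) := by
  norm_num

/-! ## Part 4. d = 3: the star to the even-weight code {000, 011, 101, 110} — 23 cubes, length 2 -/

/-- The four branch ends at d = 3: the even-weight vertices of the cube of index 0. [folklore] -/
def S3 : List (Pt 3) := [![0, 0, 0], ![0, 1, 1], ![1, 0, 1], ![1, 1, 0]]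

/-- The branch ends of `S3` are vertices of the cube of index 0. [folklore] -/
theorem S3_01 : ∀ s ∈ S3, ∀ i, s i = 0 ∨ s i = 1 := by decide

/-- The centre star `S3` meets exactly 23 cubes (kernel evaluation; inclusion–exclusion: 32 − 12 + 4 − 1). [folklore] -/
theorem card_starCubes_S3 : (starCubes S3).card = 23 := by decide +kernel

/-- The centre star `S3` has sup-length 2. [folklore] -/
theorem len_ctrStar_S3 : len (ctrStar S3) = 2 := by
  rw [len_ctrStar (by norm_num) S3_01]
  norm_num [S3]

/-- TREE FLOOR AT d = 3: every valid slope satisfies c ≥ 15/2 (23 ≤ 2c + 8). [folklore] -/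
theorem tree_count_floor_three {c : ℝ}
    (h : ∀ (Y : Finset (Pt 3)) (T : List (Seg 3)), SAdmissible Y T → (Y.card : ℝ) ≤ c * len T + 2 ^ 3) :
    (15 : ℝ) / 2 ≤ c := by
  have h1 := card_starCubes_le (by norm_num) (by simp [S3]) S3_01 h
  rw [card_starCubes_S3] at h1
  norm_num [S3] at h1
  linarith

/-- THE CONJECTURED TREE SLOPE 2^d − 1 FAILS AT d = 3 (23 > 7·2 + 8 = 22). [folklore] -/
theorem conj_slope_fails_three :
    ¬ ∀ (Y : Finset (Pt 3)) (T : List (Seg 3)), SAdmissible Y T → (Y.card : ℝ) ≤ (2 ^ 3 - 1) * len T + 2 ^ 3 := by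
  intro h
  have := tree_count_floor_three h
  norm_num at this

/-! ## Part 5. Every d ≥ 2: the three-branch star to 0, (1,…,1), (1,1,0,…,0) — 11·2^{d−2} − 4 cubes, length 3/2 -/

/-- The vertex (1,…,1). [folklore] -/
def ones : Pt d := fun _ => 1

/-- The vertex (1,1,0,…,0) (weight 2 when d ≥ 2). [folklore] -/
def utwo : Pt d := fun i => if (i : ℕ) < 2 then 1 else 0

/-- The three branch ends 0, (1,…,1), (1,1,0,…,0). [folklore] -/
def threeStar (d : ℕ) : List (Pt d) := [0, ones, utwo]

/-- The branch ends of `threeStar d` are vertices of the cube of index 0. [folklore] -/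
theorem threeStar_01 : ∀ s ∈ threeStar d, ∀ i, s i = 0 ∨ s i = 1 := by
  intro s hs i
  simp only [threeStar, List.mem_cons, List.not_mem_nil, or_false] at hs
  rcases hs with rfl | rfl | rfl
  · exact Or.inl rfl
  · exact Or.inr rfl
  · simp only [utwo]
    split_ifs
    · exact Or.inr rfl
    · exact Or.inl rfl

/-- One cube — the cube of index 0 — is at both 0 and (1,…,1). [folklore] -/
theorem card_touch_zero_inter_ones : (touch (0 : Pt d) ∩ touch ones).card = 1 := by
  rw [card_touch_inter, Finset.prod_eq_one]
  intro i _
  simp only [Pi.zero_apply, ones]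
  decide

/-- 2^{d−2} cubes are at both 0 and (1,1,0,…,0) (d ≥ 2). [folklore] -/
theorem card_touch_zero_inter_utwo (hd : 2 ≤ d) : (touch (0 : Pt d) ∩ touch utwo).card = 2 ^ (d - 2) := by
  rw [card_touch_inter]
  have hf : ∀ i : Fin d, (({(0 : Pt d) i - 1, (0 : Pt d) i} ∩ {utwo i - 1, utwo i} : Finset ℤ)).card
      = (fun n : ℕ => if n < 2 then 1 else 2) (i : ℕ) := by
    intro i
    simp only [Pi.zero_apply, utwo]
    split_ifs <;> decide
  rw [Finset.prod_congr rfl fun i _ => hf i, Fin.prod_univ_eq_prod_range (fun n : ℕ => if n < 2 then 1 else 2) d]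
  obtain ⟨m, rfl⟩ := Nat.exists_eq_add_of_le' hd
  rw [Finset.prod_range_succ', Finset.prod_range_succ']
  simp

/-- 4 cubes are at both (1,…,1) and (1,1,0,…,0) (d ≥ 2). [folklore] -/
theorem card_touch_ones_inter_utwo (hd : 2 ≤ d) : (touch (ones : Pt d) ∩ touch utwo).card = 4 := by
  rw [card_touch_inter]
  have hf : ∀ i : Fin d, (({(ones : Pt d) i - 1, (ones : Pt d) i} ∩ {utwo i - 1, utwo i} : Finset ℤ)).card
      = (fun n : ℕ => if n < 2 then 2 else 1) (i : ℕ) := by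
    intro i
    simp only [ones, utwo]
    split_ifs <;> decide
  rw [Finset.prod_congr rfl fun i _ => hf i, Fin.prod_univ_eq_prod_range (fun n : ℕ => if n < 2 then 2 else 1) d]
  obtain ⟨m, rfl⟩ := Nat.exists_eq_add_of_le' hd
  rw [Finset.prod_range_succ', Finset.prod_range_succ']
  simp

/-- THE THREE-STAR COUNT: the star to 0, (1,…,1), (1,1,0,…,0) meets exactly 11·2^{d−2} − 4 cubes (d ≥ 2), by
inclusion–exclusion: 3·2^d − (1 + 2^{d−2} + 4) + 1. [folklore] -/
theorem card_starCubes_threeStar (hd : 2 ≤ d) : (starCubes (threeStar d)).card + 4 = 11 * 2 ^ (d - 2) := by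
  have hpow : 2 ^ d = 4 * 2 ^ (d - 2) := by
    obtain ⟨m, rfl⟩ := Nat.exists_eq_add_of_le' hd
    rw [Nat.add_sub_cancel, pow_add]
    ring
  have hS : starCubes (threeStar d) = touch 0 ∪ (touch ones ∪ touch utwo) := by simp [threeStar]
  have h1 := Finset.card_union_add_card_inter (touch (0 : Pt d)) (touch ones ∪ touch utwo)
  have h2 := Finset.card_union_add_card_inter (touch (ones : Pt d)) (touch utwo)
  have h3 : touch (0 : Pt d) ∩ (touch ones ∪ touch utwo) = touch 0 ∩ touch ones ∪ touch 0 ∩ touch utwo := by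
    ext x
    simp only [Finset.mem_inter, Finset.mem_union]
    tauto
  have h4 := Finset.card_union_add_card_inter (touch (0 : Pt d) ∩ touch ones) (touch 0 ∩ touch utwo)
  have h5 : (touch (0 : Pt d) ∩ touch ones ∩ (touch 0 ∩ touch utwo)).card = 1 := by
    refine le_antisymm ?_ (Finset.card_pos.2 ⟨0, ?_⟩)
    · calc (touch (0 : Pt d) ∩ touch ones ∩ (touch 0 ∩ touch utwo)).card ≤ (touch (0 : Pt d) ∩ touch ones).card :=
            Finset.card_le_card Finset.inter_subset_left
        _ = 1 := card_touch_zero_inter_ones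
    · simp only [Finset.mem_inter]
      exact ⟨⟨zero_mem_touch fun _ => Or.inl rfl, zero_mem_touch fun _ => Or.inr rfl⟩,
        zero_mem_touch fun _ => Or.inl rfl, zero_mem_touch (threeStar_01 utwo (by simp [threeStar]))⟩
  rw [h3, card_touch] at h1
  rw [card_touch_zero_inter_ones, card_touch_zero_inter_utwo hd, h5] at h4
  rw [card_touch, card_touch, card_touch_ones_inter_utwo hd] at h2
  rw [hS]
  omega

/-- THE THREE-STAR FLOOR: every slope c with `SAdmissible Y T → #Y ≤ c·len T + 2^d` for all Y, T satisfies
c ≥ (7·2^{d−1} − 8)/3 (d ≥ 2; this exceeds the path slope 2^d − 1 iff d ≥ 4). [folklore] -/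
theorem count_floor_threeStar (hd : 2 ≤ d) {c : ℝ}
    (h : ∀ (Y : Finset (Pt d)) (T : List (Seg d)), SAdmissible Y T → (Y.card : ℝ) ≤ c * len T + 2 ^ d) :
    (7 * (2 : ℝ) ^ (d - 1) - 8) / 3 ≤ c := by
  have h1 := card_starCubes_le (by omega) (by simp [threeStar]) threeStar_01 h
  have hcard : ((starCubes (threeStar d)).card : ℝ) + 4 = 11 * 2 ^ (d - 2) := by
    exact_mod_cast card_starCubes_threeStar hd
  have hl : ((threeStar d).length : ℝ) = 3 := by simp [threeStar]
  rw [hl] at h1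
  obtain ⟨m, rfl⟩ := Nat.exists_eq_add_of_le' hd
  simp only [Nat.add_sub_cancel, show m + 2 - 1 = m + 1 by omega] at hcard h1 ⊢
  rw [pow_succ] 
  rw [pow_succ, pow_succ] at h1
  linarith

/-- THE CONJECTURED TREE SLOPE 2^d − 1 FAILS IN EVERY DIMENSION d ≥ 3: the count `#Y ≤ (2^d − 1)·len T + 2^d`, valid
and sharp for polygonal paths (`SupCountCeiling.card_le_of_isPath_sAdmissible`, `path_slope_sharp`), is violated by a
centre star (d = 3: `S3`; d ≥ 4: `threeStar d`).  So the optimal tree slope strictly exceeds the optimal path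
slope. [folklore] -/
theorem conj_slope_fails (hd : 3 ≤ d) :
    ¬ ∀ (Y : Finset (Pt d)) (T : List (Seg d)), SAdmissible Y T → (Y.card : ℝ) ≤ (2 ^ d - 1) * len T + 2 ^ d := by
  rcases Nat.lt_or_ge d 4 with h4 | h4
  · obtain rfl : d = 3 := by omega
    exact conj_slope_fails_three
  · intro h
    have h1 := count_floor_threeStar (by omega) h
    have h8 : (8 : ℝ) ≤ 2 ^ (d - 1) := by
      have : (2 : ℝ) ^ 3 ≤ 2 ^ (d - 1) := pow_le_pow_right₀ (by norm_num) (by omega)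
      norm_num at this
      exact this
    have h2 : (2 : ℝ) ^ d = 2 * 2 ^ (d - 1) := by
      rw [← pow_succ']
      congr 1
      omega
    rw [h2] at h1
    linarith

/-- The general floor strictly exceeds the path slope for d ≥ 4, and the d = 4 star `S4` improves it further there:
(7·2^3 − 8)/3 = 16 < 35/2. [folklore] -/
theorem threeStar_floor_four : (7 * (2 : ℝ) ^ (4 - 1) - 8) / 3 = 16 ∧ (16 : ℝ) < 35 / 2 := by
  norm_num

end

end Literature.MathematicalPhysics.QuantumFieldTheory.Balaban1983to89.B16.SupCountBranching
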